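import Summits.ValiantsHypothesis.ValiantsHypothesis.Theorems.FifoMatchingNNDivisionHardExactPencilSubexpCubeCount
import HarnessLib

/-! # Exact pencils, D1 part 16b (port of `Cruxes/NNDivisionHard/ExactPencil38c.lean` rev 1 @e32933e05cb2 §13d-D, val-idea-38 g4; crux `FifoMatching.NNDivisionHard`, stmt-ValiantsHypothesis-21181; crit-9 g4 V#140b KERNEL VERIFIED + CONTENT GO) — THE ZONOTOPE CLOSURE LEMMA

§13d ★★★ `cor_add_subexpGenCube_decided`: EVERY affine cube passenger `{Q₀ + Σ_{t∈P} G_t : P ⊆ [N]}` with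
`N + K(c,n) < 2^{⌊n / 4K(c,n)⌋}` generators (`K(c,n) = 2(log₂ n + c)^c + 6`) is DECIDED — `T c n < r` for every EF of size `r` of
`COR(n) + cube` — with NO hypothesis on the generators (memo `ExactPencil38.md` §2i «zonotope closure lemma», steps (ii)+(iii), paper
PASS val-idea-crit-9 V#113a; there with equipartitions and the constant `2^{n/(2K)−2}`, here with ALL labellings `Fin n → Fin K` counted by
`Fintype.piFinset`, constant `2^{⌊n/4K⌋} − K`).

PROOF.  Fix a dead set `Z ≠ ∅` with `|Zᶜ| ≥ n/2` and a labelling `f : Fin n → Fin K` of the live rows; the located pair is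
`β = lab Z f : Fin n → Fin (K+1)` (dead label `Fin.last K`).  By D1 part 15 ★★★ `cor_add_bound_of_cube_offT` the cube is decided at `(Z, β)`
unless some nonzero generator is UNREAD (zero on dead rows/columns, symmetric, row-constant inside every live block).  COUNTING
(`exists_good_fun`): among the `K^n` labellings, those missing a live label on `Zᶜ` (`≤ K·(K−1)^m K^{n−m}`) and those separating NO
pair of unequal live rows of a fixed generator (`≤ (K−1)^m K^{n−m}` each, `m = ⌊n/4⌋`: the smaller row class has `≥ |Zᶜ|/2` live rows
outside it, all of which must dodge one label) are fewer than `K^n` as soon as `(N + K)(K−1)^m < K^m`, which `N + K < 2^{⌊n/4K⌋}` gives through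
`K^K ≥ 2(K−1)^K` (ℕ-Bernoulli).  Under a good labelling an unread generator has all live rows equal, hence is `c·𝟙_{Zᶜ}𝟙_{Zᶜ}ᵀ`, `c ≠ 0`
(`offT_or_constOn`), and `Z ↦` such a generator is INJECTIVE (`constOn_inj`: `x ∈ Z ↔ g x x = 0`).  Running `Z` over the `2^{n−⌊n/2⌋} − 1 > N`
nonempty subsets of a fixed half `H` gives the contradiction.

Second of TWO files (400-line rule): the ℕ-numerics, the located pair `lab` / unread shape `ConstOn` / dichotomy `offT_or_constOn` and the
counting lemma `exists_good_fun` are in the sibling `Theorems/FifoMatchingNNDivisionHardExactPencilSubexpCubeCount.lean` (D1 part 16a),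
imported here.  All texts VERBATIM from the staged kit `pub/ideators/val-idea-38/staged/port-ExactPencil38c/` dfd82fecda70c111.

HONEST LABEL: an instance theorem (DECIDED SPECIES: affine cubes with sub-exponentially many generators) of the OPEN law
C′ = `LocatedRows.ExactPencilLaw` ≡ COR-VIRTUAL (`exactPencilLaw_iff_corVirtualHardN` ✓ p688316); the residual cube portrait
(`N ≥ 2^{⌊n/4K⌋} − K` generators, `𝒥`-type, (E-0) budget on the enemy) is untouched; the crux 21181 `NNDivisionHard` is OPEN; 0 enemies
in sight.  VP ≠ VNP is NOT proved here or anywhere in this tree.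
-/

set_option autoImplicit false

-- the mandated summit-side namespace repeats a component by design (single-problem summit)
set_option linter.dupNamespace false

noncomputable section

open Matrix Finset
open scoped Pointwise

namespace Summit.ValiantsHypothesis.ValiantsHypothesis.Theorems.FifoMatching.ExactPencil.SubexpCube

open Literature.Barriers.PneNP (HasEFOfSize)
open Literature.Combinatorics.Optimization.FixedSizePsdRank (corPolytope flat)
open Summit.ValiantsHypothesis.ValiantsHypothesis.Theorems.FifoMatching.LocatedRows (T cubePt)

/-! ### §13d-D ★★★ THE ZONOTOPE CLOSURE LEMMA -/

section Closure

variable {n : ℕ}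

/-- two unequal live rows ⇒ a base row `x₀ ∉ Z` and a set `M₀` of at least `|Zᶜ|/2` live rows all unequal to row `x₀`
(the complement in `Zᶜ` of the SMALLER of the two row classes). -/
theorem exists_base_and_far {g : Matrix (Fin n) (Fin n) ℝ} {Z : Finset (Fin n)}
    (h : ∃ x₁, x₁ ∉ Z ∧ ∃ x₂, x₂ ∉ Z ∧ ∃ y, g x₁ y ≠ g x₂ y) :
    ∃ (x₀ : Fin n) (M₀ : Finset (Fin n)), x₀ ∉ Z ∧ x₀ ∉ M₀ ∧ Zᶜ.card / 2 ≤ M₀.card ∧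
      ∀ x' ∈ M₀, x' ∉ Z ∧ ∃ y, g x₀ y ≠ g x' y := by
  classical
  obtain ⟨x₁, hx₁, x₂, hx₂, y, hy⟩ := h
  have hne : g x₁ ≠ g x₂ := fun he => hy (congrFun he y)
  let far : Fin n → Finset (Fin n) := fun x₀ => Zᶜ.filter fun x' => ¬ g x' = g x₀
  have hfar : ∀ x₀, ∀ x' ∈ far x₀, x' ∉ Z ∧ ∃ y, g x₀ y ≠ g x' y := by
    intro x₀ x' hx'
    dsimp only [far] at hx'
    rw [Finset.mem_filter, Finset.mem_compl] at hx'
    exact ⟨hx'.1, Function.ne_iff.1 (Ne.symm hx'.2)⟩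
  have hself : ∀ x₀, x₀ ∉ far x₀ := fun x₀ h => by simp [far] at h
  have hsum : Zᶜ.card ≤ (far x₁).card + (far x₂).card := by
    have h1 : (Zᶜ.filter fun x' => g x' = g x₁).card + (far x₁).card = Zᶜ.card :=
      Finset.card_filter_add_card_filter_not _
    have h2 : (Zᶜ.filter fun x' => g x' = g x₁) ⊆ far x₂ := by
      intro x' hx'
      dsimp only [far]
      rw [Finset.mem_filter] at hx' ⊢
      exact ⟨hx'.1, fun he => hne (hx'.2.symm.trans he)⟩
    have := Finset.card_le_card h2
    omega
  by_cases hc : Zᶜ.card / 2 ≤ (far x₁).card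
  · exact ⟨x₁, far x₁, hx₁, hself x₁, hc, hfar x₁⟩
  · exact ⟨x₂, far x₂, hx₂, hself x₂, by omega, hfar x₂⟩

/-- ★★★ **THE ZONOTOPE CLOSURE LEMMA** (memo `ExactPencil38.md` §2i, steps (ii)+(iii), now kernel): EVERY affine cube passenger
`{Q₀ + Σ_{t∈P} G_t : P ⊆ [N]}` with `N + K(c,n) < 2^{⌊n/4K(c,n)⌋}` generators, `K(c,n) = 2(log₂ n + c)^c + 6`, is DECIDED —
`T c n < r` for every EF of size `r` of `COR(n) + cube` — with NO hypothesis on the generators, for every such `n`. -/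
theorem cor_add_subexpGenCube_decided (c : ℕ) {N : ℕ}
    (hN : N + (2 * (Nat.log 2 n + c) ^ c + 6) < 2 ^ (n / (4 * (2 * (Nat.log 2 n + c) ^ c + 6))))
    (Q₀ : Matrix (Fin n) (Fin n) ℝ) (G : Fin N → Matrix (Fin n) (Fin n) ℝ) (r : ℕ)
    (hEF : HasEFOfSize (corPolytope n + convexHull ℝ (Set.range (cubePt Q₀ G))) r) : T c n < r := by
  classical
  set K : ℕ := 2 * (Nat.log 2 n + c) ^ c + 6 with hK
  have hK6 : 6 ≤ K := by omega
  -- numerics: `n ≥ 12K`, the threshold `(N + K)(K−1)^{n/4} < K^{n/4}`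
  have hq3 : 3 ≤ n / (4 * K) := by
    by_contra hlt
    have h4 : 2 ^ (n / (4 * K)) ≤ 4 :=
      le_trans (Nat.pow_le_pow_right (by norm_num) (by omega : n / (4 * K) ≤ 2)) (by norm_num)
    omega
  have hn : 12 * K ≤ n := by
    have := (Nat.le_div_iff_mul_le (by omega : 0 < 4 * K)).1 hq3
    omega
  have hq4 : n / (4 * K) ≤ n / 4 := Nat.div_le_div_left (by omega) (by norm_num)
  have hqm : n / (4 * K) * K ≤ n / 4 := by
    rw [← Nat.div_div_eq_div_mul]
    exact Nat.div_mul_le_self _ _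
  have hthr : (N + K) * (K - 1) ^ (n / 4) < K ^ (n / 4) :=
    threshold_lt N K (n / (4 * K)) (n / 4) (by omega) hN hqm
  by_contra hr
  -- the half `H` and the family of dead sets: nonempty subsets of `H`
  obtain ⟨H, -, hH⟩ := Finset.exists_subset_card_eq (s := (Finset.univ : Finset (Fin n))) (n := n - n / 2)
    (by rw [Finset.card_univ, Fintype.card_fin]; omega)
  set Fam : Finset (Finset (Fin n)) := H.powerset.erase ∅ with hFam
  have hFam_mem : ∀ Z ∈ Fam, Z.Nonempty ∧ n / 2 ≤ Zᶜ.card := by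
    intro Z hZ
    rw [hFam, Finset.mem_erase, Finset.mem_powerset] at hZ
    refine ⟨Finset.nonempty_iff_ne_empty.2 hZ.1, ?_⟩
    rw [Finset.card_compl, Fintype.card_fin]
    have := Finset.card_le_card hZ.2
    omega
  have hHFam : H ∈ Fam := by
    rw [hFam, Finset.mem_erase, Finset.mem_powerset]
    refine ⟨fun he => ?_, subset_rfl⟩
    rw [he, Finset.card_empty] at hH
    omega
  -- ★ every dead set of the family owns an UNREAD generator `c·𝟙_{Zᶜ}𝟙_{Zᶜ}ᵀ`
  have hex : ∀ Z ∈ Fam, ∃ t, ConstOn (G t) Z := by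
    intro Z hZ
    obtain ⟨hZne, hZc⟩ := hFam_mem Z hZ
    have hL : ∃ x₀, x₀ ∉ Z := by
      obtain ⟨x₀, hx₀⟩ := (Finset.card_pos.1 (by omega) : Zᶜ.Nonempty)
      exact ⟨x₀, Finset.mem_compl.1 hx₀⟩
    -- base rows `x t` and far sets `M t` for the generators with two unequal live rows
    have hxM : ∀ t : Fin N, ∃ (x₀ : Fin n) (M₀ : Finset (Fin n)), x₀ ∉ M₀ ∧
        ((∃ x₁, x₁ ∉ Z ∧ ∃ x₂, x₂ ∉ Z ∧ ∃ y, G t x₁ y ≠ G t x₂ y) →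
          x₀ ∉ Z ∧ n / 4 ≤ M₀.card ∧ ∀ x' ∈ M₀, x' ∉ Z ∧ ∃ y, G t x₀ y ≠ G t x' y) := by
      intro t
      by_cases hMC : ∃ x₁, x₁ ∉ Z ∧ ∃ x₂, x₂ ∉ Z ∧ ∃ y, G t x₁ y ≠ G t x₂ y
      · obtain ⟨x₀, M₀, hx₀Z, hx₀M, hcard, hM⟩ := exists_base_and_far hMC
        exact ⟨x₀, M₀, hx₀M, fun _ => ⟨hx₀Z, by omega, hM⟩⟩
      · obtain ⟨x₀, -⟩ := hL
        exact ⟨x₀, ∅, by simp, fun h => (hMC h).elim⟩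
    choose x M hxM hgoodM using hxM
    let I : Finset (Fin N) := Finset.univ.filter fun t =>
      ∃ x₁, x₁ ∉ Z ∧ ∃ x₂, x₂ ∉ Z ∧ ∃ y, G t x₁ y ≠ G t x₂ y
    have hI : ∀ t ∈ I, ∃ x₁, x₁ ∉ Z ∧ ∃ x₂, x₂ ∉ Z ∧ ∃ y, G t x₁ y ≠ G t x₂ y := fun t ht =>
      (Finset.mem_filter.1 ht).2
    have hnum : (I.card + K) * ((K - 1) ^ (n / 4) * K ^ (n - n / 4)) < K ^ n := by
      have hIN : I.card ≤ N := by
        calc I.card ≤ (Finset.univ : Finset (Fin N)).card := Finset.card_le_card (Finset.filter_subset _ _)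
          _ = N := by rw [Finset.card_univ, Fintype.card_fin]
      have hpos : 0 < K ^ (n - n / 4) := Nat.pow_pos (by omega)
      calc (I.card + K) * ((K - 1) ^ (n / 4) * K ^ (n - n / 4))
          ≤ (N + K) * ((K - 1) ^ (n / 4) * K ^ (n - n / 4)) := Nat.mul_le_mul_right _ (by omega)
        _ = (N + K) * (K - 1) ^ (n / 4) * K ^ (n - n / 4) := by ring
        _ < K ^ (n / 4) * K ^ (n - n / 4) := Nat.mul_lt_mul_of_pos_right hthr hpos
        _ = K ^ n := by rw [← pow_add]; congr 1; omega
    obtain ⟨f, hsurj, hcoll⟩ := exists_good_fun I Z x M (fun t _ => hxM t) (n / 4)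
      (fun t ht => (hgoodM t (hI t ht)).2.1) (by omega) hnum
    obtain ⟨σ, hσ⟩ := lab_section Z f hZne hsurj
    by_contra hnone
    push Not at hnone
    have hread : ∀ t, G t ≠ 0 →
        (∃ x y, G t x y ≠ 0 ∧ (lab Z f x ∈ ({Fin.last K} : Finset (Fin (K + 1))) ∨
            lab Z f y ∈ ({Fin.last K} : Finset (Fin (K + 1))))) ∨
          (∃ x x' y, lab Z f x = lab Z f x' ∧ G t x y ≠ G t x' y) ∨
          (∃ x y y', lab Z f y = lab Z f y' ∧ G t x y ≠ G t x y') ∨ (∃ x y, G t x y ≠ G t y x) := by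
      intro t ht
      refine (offT_or_constOn Z f (G t) ht hL fun hMC => ?_).resolve_right (hnone t)
      have htI : t ∈ I := Finset.mem_filter.2 ⟨Finset.mem_univ t, hMC⟩
      obtain ⟨x', hx'M, hfx'⟩ := hcoll t htI
      obtain ⟨hxZ, -, hM⟩ := hgoodM t hMC
      obtain ⟨hx'Z, y, hy⟩ := hM x' hx'M
      exact ⟨x t, x', hxZ, hx'Z, hfx'.symm, y, hy⟩
    have hbound := cor_add_bound_of_cube_offT hσ ({Fin.last K} : Finset (Fin (K + 1))) Q₀ G hread r hEF
    rw [Finset.card_singleton, Nat.add_sub_cancel] at hbound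
    exact hr (T_lt_of_block_uniform c n K r hK.ge hbound)
  -- ★ `Z ↦` its unread generator is injective on the family: `2^{n − ⌊n/2⌋} − 1 ≤ N`, contradiction
  rcases Nat.eq_zero_or_pos N with hN0 | hNpos
  · subst hN0
    obtain ⟨t, -⟩ := hex H hHFam
    exact t.elim0
  haveI : Nonempty (Fin N) := ⟨⟨0, hNpos⟩⟩
  choose! tZ htZ using hex
  have hinj : Set.InjOn tZ (Fam : Set (Finset (Fin n))) := by
    intro Z hZ Z' hZ' he
    exact constOn_inj (htZ Z hZ) (he ▸ htZ Z' hZ')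
  have hcard : Fam.card ≤ N := by
    calc Fam.card ≤ (Finset.univ : Finset (Fin N)).card :=
          Finset.card_le_card_of_injOn tZ (by intro Z _; exact Finset.mem_coe.2 (Finset.mem_univ _)) hinj
      _ = N := by rw [Finset.card_univ, Fintype.card_fin]
  have hFam_card : Fam.card = 2 ^ (n - n / 2) - 1 := by
    rw [hFam, Finset.card_erase_of_mem (Finset.mem_powerset.2 (Finset.empty_subset H)), Finset.card_powerset, hH]
  have h2 : 2 ^ (n / (4 * K)) ≤ 2 ^ (n - n / 2) := Nat.pow_le_pow_right (by norm_num) (by omega)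
  omega

end Closure

end Summit.ValiantsHypothesis.ValiantsHypothesis.Theorems.FifoMatching.ExactPencil.SubexpCube

end
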